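import Mathlib
import HarnessLib
import HarnessLib.Audit
import Summits.RiemannHypothesis.Statement

/-!
# Theses-free copies of the route propositions of route `OddSector` (build refactor)

This module restates, as plain `def … : Prop` with the SAME terms, every statement item of the route file
`Summits/RiemannHypothesis/RiemannHypothesis/Theses/OddSector.lean` (namespace
`Summit.RiemannHypothesis.RiemannHypothesis.Theses.OddSector`), in the namespace
`Summit.RiemannHypothesis.RiemannHypothesis.Theorems.WeilRouteProps.OddSector` (the route's deciding theorem `closes` is
deliberately NOT copied — gate5 ruling 2026-08-26T22:17Z).

WHY (21-frontier standing build rule 2026-08-26T18:52:29Z; director-rh BRIEF-weil-import-refactor): only LEAF modules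
(closers nobody imports) may import a `Theses` (route) file, so that a route edit invalidates a few dozen leaves instead of
the ≈3 000-module cone that used to hang below the route file. Towers, certificate shards and libraries that need to
MENTION a route proposition (as a hypothesis or in a type) import this module instead; it imports exactly what the route
file imports and never a `Theses` file.

Each copy is definitionally equal to the route declaration (same term); the leaf
`Theorems/WeilRouteProps/OddSectorIff.lean` records `Theorems.WeilRouteProps.OddSector.X ↔ Theses.OddSector.X` by `Iff.rfl` for every
item `X`, so a closer proves the route declaration from a tower theorem about the copy by `exact` (definitional unfolding)
or through that `Iff`. These definitions are NOT route items (no `@[route_item]`), carry no status, and must be kept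
textually in sync with the route file if a statement is ever restated (the `Iff.rfl` leaf then fails loudly).
Nothing here bears on the truth of RH.
-/

namespace Summit.RiemannHypothesis.RiemannHypothesis.Theorems.WeilRouteProps.OddSector

open scoped BigOperators Topology Manifold Classical MeasureTheory ProbabilityTheory Matrix InnerProductSpace ComplexConjugate ContinuousMap
open Filter Set Function TopologicalSpace MeasureTheory
open Summit

/-- Theses-free copy (build refactor) of the route proposition
`Summit.RiemannHypothesis.RiemannHypothesis.Theses.OddSector.OddOneSignedWindows` (item stmt-RiemannHypothesis-17778, crux): the same term, hence
definitionally equal to it (`WeilRouteProps.OddSectorIff`). Not a route item; see the route file for the informal statement,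
status and sources. -/
def OddOneSignedWindows : Prop :=
  let C : (ℝ → ℂ) → ℝ → ℂ := fun g => MeasureTheory.convolution g (fun t => (starRingEnd ℂ) (g (-t))) (ContinuousLinearMap.mul ℂ ℂ) MeasureTheory.MeasureSpace.volume; let M : (ℝ → ℂ) → ℂ → ℂ := fun F s => ∫ t : ℝ, F t * Complex.exp ((s - 1 / 2) * t); let Q : (ℝ → ℂ) → ℂ := fun g => M (C g) 0 + M (C g) 1 - (∑' n : ℕ, ((ArithmeticFunction.vonMangoldt n : ℝ) : ℂ) / (Real.sqrt n : ℂ) * (C g (Real.log n) + C g (-Real.log n))) + ((1 / (2 * Real.pi) : ℂ) * (∫ t : ℝ, M (C g) (1 / 2 + t * Complex.I) * ((Complex.digamma (1 / 4 + t / 2 * Complex.I)).re : ℂ)) - C g 0 * (Real.log Real.pi : ℂ)); ∀ A : ℝ, ∃ a : ℝ, A ≤ a ∧ ∃ u : ℝ → ℂ, (MeasureTheory.MemLp u 2 ∧ ∃ g : ℕ → ℝ → ℂ, (∀ n, (ContDiff ℝ ((⊤ : ℕ∞) : WithTop ℕ∞) (g n) ∧ HasCompactSupport (g n)) ∧ tsupport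 (g n) ⊆ Set.Icc (-a) a ∧ (∀ t, g n (-t) = -g n t) ∧ ∫ t, ‖g n t‖ ^ 2 = (1 : ℝ)) ∧ (∀ h : ℝ → ℂ, (ContDiff ℝ ((⊤ : ℕ∞) : WithTop ℕ∞) h ∧ HasCompactSupport h) → tsupport h ⊆ Set.Icc (-a) a → (∀ t, h (-t) = -h t) → ∫ t, ‖h t‖ ^ 2 = (1 : ℝ) → ∀ δ : ℝ, 0 < δ → ∀ᶠ n in Filter.atTop, (Q (g n)).re ≤ (Q h).re + δ) ∧ Filter.Tendsto (fun n => ∫ t, ‖g n t - u t‖ ^ 2) Filter.atTop (nhds 0)) ∧ (∀ᵐ t : ℝ, t ∈ Set.Ioo 0 a → (u t).im = 0 ∧ 0 ≤ (u t).re)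

/-- Theses-free copy (build refactor) of the route proposition
`Summit.RiemannHypothesis.RiemannHypothesis.Theses.OddSector.OddBartaFloor` (item stmt-RiemannHypothesis-17779, crux): the same term, hence
definitionally equal to it (`WeilRouteProps.OddSectorIff`). Not a route item; see the route file for the informal statement,
status and sources. -/
def OddBartaFloor : Prop :=
  let C : (ℝ → ℂ) → ℝ → ℂ := fun g => MeasureTheory.convolution g (fun t => (starRingEnd ℂ) (g (-t))) (ContinuousLinearMap.mul ℂ ℂ) MeasureTheory.MeasureSpace.volume; let M : (ℝ → ℂ) → ℂ → ℂ := fun F s => ∫ t : ℝ, F t * Complex.exp ((s - 1 / 2) * t); let Q : (ℝ → ℂ) → ℂ := fun g => M (C g) 0 + M (C g) 1 - (∑' n : ℕ, ((ArithmeticFunction.vonMangoldt n : ℝ) : ℂ) / (Real.sqrt n : ℂ) * (C g (Real.log n) + C g (-Real.log n))) + ((1 / (2 * Real.pi) : ℂ) * (∫ t : ℝ, M (C g) (1 / 2 + t * Complex.I) * ((Complex.digamma (1 / 4 + t / 2 * Complex.I)).re : ℂ)) - C g 0 * (Real.log Real.pi : ℂ)); ∃ e : ℝ → ℝ, Filter.Tendsto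 e Filter.atTop (nhds 0) ∧ ∃ a₀ : ℝ, ∀ a : ℝ, a₀ ≤ a → (∃ u : ℝ → ℂ, (MeasureTheory.MemLp u 2 ∧ ∃ g : ℕ → ℝ → ℂ, (∀ n, (ContDiff ℝ ((⊤ : ℕ∞) : WithTop ℕ∞) (g n) ∧ HasCompactSupport (g n)) ∧ tsupport (g n) ⊆ Set.Icc (-a) a ∧ (∀ t, g n (-t) = -g n t) ∧ ∫ t, ‖g n t‖ ^ 2 = (1 : ℝ)) ∧ (∀ h : ℝ → ℂ, (ContDiff ℝ ((⊤ : ℕ∞) : WithTop ℕ∞) h ∧ HasCompactSupport h) → tsupport h ⊆ Set.Icc (-a) a → (∀ t, h (-t) = -h t) → ∫ t, ‖h t‖ ^ 2 = (1 : ℝ) → ∀ δ : ℝ, 0 < δ → ∀ᶠ n in Filter.atTop, (Q (g n)).re ≤ (Q h).re + δ) ∧ Filter.Tendsto (fun n => ∫ t, ‖g n t - u t‖ ^ 2) Filter.atTop (nhds 0)) ∧ (∀ᵐ t : ℝ, t ∈ Set.Ioo 0 a → (u t).im = 0 ∧ 0 ≤ (u t).re)) → ∀ h : ℝ → ℂ,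 (ContDiff ℝ ((⊤ : ℕ∞) : WithTop ℕ∞) h ∧ HasCompactSupport h) → tsupport h ⊆ Set.Icc (-a) a → (∀ t, h (-t) = -h t) → ∫ t, ‖h t‖ ^ 2 = (1 : ℝ) → -e a ≤ (Q h).re

/-- Theses-free copy (build refactor) of the route proposition
`Summit.RiemannHypothesis.RiemannHypothesis.Theses.OddSector.OddNegativityOffLine` (item stmt-RiemannHypothesis-17780, crux): the same term, hence
definitionally equal to it (`WeilRouteProps.OddSectorIff`). Not a route item; see the route file for the informal statement,
status and sources. -/
def OddNegativityOffLine : Prop :=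
  let C : (ℝ → ℂ) → ℝ → ℂ := fun g => MeasureTheory.convolution g (fun t => (starRingEnd ℂ) (g (-t))) (ContinuousLinearMap.mul ℂ ℂ) MeasureTheory.MeasureSpace.volume; let M : (ℝ → ℂ) → ℂ → ℂ := fun F s => ∫ t : ℝ, F t * Complex.exp ((s - 1 / 2) * t); let Q : (ℝ → ℂ) → ℂ := fun g => M (C g) 0 + M (C g) 1 - (∑' n : ℕ, ((ArithmeticFunction.vonMangoldt n : ℝ) : ℂ) / (Real.sqrt n : ℂ) * (C g (Real.log n) + C g (-Real.log n))) + ((1 / (2 * Real.pi) : ℂ) * (∫ t : ℝ, M (C g) (1 / 2 + t * Complex.I) * ((Complex.digamma (1 / 4 + t / 2 * Complex.I)).re : ℂ)) - C g 0 * (Real.log Real.pi : ℂ)); ¬ RiemannHypothesis → ∃ η : ℝ, 0 < η ∧ ∃ A : ℝ, ∀ a : ℝ, A ≤ a → ∃ h : ℝ → ℂ, (ContDiff ℝ ((⊤ : ℕ∞) : WithTop ℕ∞) h ∧ HasCompactSupport h) ∧ tsupport h ⊆ Set.Icc (-a) a ∧ (∀ t, h (-t) = -h t) ∧ ∫ t,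 ‖h t‖ ^ 2 = (1 : ℝ) ∧ (Q h).re ≤ -η

/-- Theses-free copy (build refactor) of the route proposition
`Summit.RiemannHypothesis.RiemannHypothesis.Theses.OddSector.OddArchAnchor` (item stmt-RiemannHypothesis-17781, support): the same term, hence
definitionally equal to it (`WeilRouteProps.OddSectorIff`). Not a route item; see the route file for the informal statement,
status and sources. -/
def OddArchAnchor : Prop :=
  let C : (ℝ → ℂ) → ℝ → ℂ := fun g => MeasureTheory.convolution g (fun t => (starRingEnd ℂ) (g (-t))) (ContinuousLinearMap.mul ℂ ℂ) MeasureTheory.MeasureSpace.volume; let M : (ℝ → ℂ) → ℂ → ℂ := fun F s => ∫ t : ℝ, F t * Complex.exp ((s - 1 / 2) * t); let Q₀ : (ℝ → ℂ) → ℂ := fun g => (1 / (2 * Real.pi) : ℂ) * (∫ t : ℝ, M (C g) (1 / 2 + t * Complex.I) * ((Complex.digamma (1 / 4 + t / 2 * Complex.I)).re : ℂ)) - C g 0 * (Real.log Real.pi : ℂ); ∀ a : ℝ, 0 < a → ∃ u : ℝ → ℂ, (MeasureTheory.MemLp u 2 ∧ ∃ g : ℕ → ℝ → ℂ, (∀ n,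 (ContDiff ℝ ((⊤ : ℕ∞) : WithTop ℕ∞) (g n) ∧ HasCompactSupport (g n)) ∧ tsupport (g n) ⊆ Set.Icc (-a) a ∧ (∀ t, g n (-t) = -g n t) ∧ ∫ t, ‖g n t‖ ^ 2 = (1 : ℝ)) ∧ (∀ h : ℝ → ℂ, (ContDiff ℝ ((⊤ : ℕ∞) : WithTop ℕ∞) h ∧ HasCompactSupport h) → tsupport h ⊆ Set.Icc (-a) a → (∀ t, h (-t) = -h t) → ∫ t, ‖h t‖ ^ 2 = (1 : ℝ) → ∀ δ : ℝ, 0 < δ → ∀ᶠ n in Filter.atTop, (Q₀ (g n)).re ≤ (Q₀ h).re + δ) ∧ Filter.Tendsto (fun n => ∫ t, ‖g n t - u t‖ ^ 2) Filter.atTop (nhds 0)) ∧ (∀ᵐ t : ℝ, t ∈ Set.Ioo 0 a → (u t).im = 0 ∧ 0 ≤ (u t).re)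

/-- Theses-free copy (build refactor) of the route proposition
`Summit.RiemannHypothesis.RiemannHypothesis.Theses.OddSector.Assembly` (item stmt-RiemannHypothesis-17364, assembly): the same term, hence
definitionally equal to it (`WeilRouteProps.OddSectorIff`). Not a route item; see the route file for the informal statement,
status and sources. -/
def Assembly : Prop :=
  OddBartaFloor → OddOneSignedWindows → OddNegativityOffLine → Summit.RiemannHypothesis

end Summit.RiemannHypothesis.RiemannHypothesis.Theorems.WeilRouteProps.OddSector
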